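import Literature.InformationTheory.Entanglement.Negativity
import HarnessLib

/-!
# The negativity of a pure state: `𝒩(|Φ⟩⟨Φ|) = ½((Σ_α c_α)² − 1)` (Vidal–Werner 2002, Proposition 8)

Hodge foundations lane (`lit-hodgefound`, prover p24 gen 77; quantum-information series, sequel of `Negativity.lean`).
THEOREMS ONLY: no definition, no named fact, net debt 0; as in `Negativity.lean` the negativity of a Hermitian `A` is
spelled `Σ_i λ_i(A)⁻`.

## Source, VERBATIM

G. Vidal, R. F. Werner, *Computable measure of entanglement*, Phys. Rev. A **65** (2002) 032314 [VidalWerner2002],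
§ V.A (held `paper:arxiv-quant-ph_0102117`, chunk p0011): «Let `ρ = |Φ⟩⟨Φ|` be a pure state, and write the wave vector
in its Schmidt decomposition `Φ = Σ_α c_α e'_α ⊗ e''_α`, where `c_α > 0` are the Schmidt coefficients of `Φ`, and
the `e^{(i)}_α` are suitable orthonormal basis. Then we get the following result. **Proposition 8:**
`𝒩(ρ) = ½((Σ_α c_α)² − 1)`. … *Proof:* Introducing the operators “flip” `𝔽 e'_α ⊗ e''_β = e'_β ⊗ e''_α`, and
`C' = Σ_α c_α|e'_α⟩⟨e'_α|`, and a similar `C''` for the second tensor factor, we find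
`(|Φ⟩⟨Φ|)^{T_1} = Σ_{αβ} c_αc_β |e'_α ⊗ e''_β⟩⟨e'_β ⊗ e''_α| = 𝔽(C' ⊗ C'')`. From the trace norm
`‖X‖₁ = tr√(X†X)` we may omit unitary factors like `𝔽`, so the trace norm is equal to the trace of the positive
operator `(C' ⊗ C'')`, namely `(Σ_α c_α)²`.»  Together with § II.A eq. (2), `‖ρ^{T_A}‖₁ = 1 + 2𝒩(ρ)`.

## Dictionary and proof route (declared deviation)

A vector of `ℂ^m ⊗ ℂ^n` with coefficient matrix `Ψ` is `fun p => Ψ p.1 p.2`; its Schmidt coefficients are the singular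
values `σ_i ≥ 0` of `Ψ` (`ΨΨ^* = U diag(σ²) U^*`), obtained from the tree's `svd_core` along an embedding `e : m ↪ n`
(`|m| ≤ |n|`).  In Schmidt coordinates the pure state is `Σ_i σ_i |i, e i⟩` and, exactly as printed,
`(|Φ⟩⟨Φ|)^{T_A} = X_S = Σ_{i,j} σ_iσ_j |i, e j⟩⟨j, e i|`.  Instead of the polar decomposition `𝔽(C' ⊗ C'')` and the
unitary invariance of the trace norm, the value of `𝒩(X_S)` is certified through the variational formula of
`Negativity.lean` (Vidal–Werner Lemma 2): the Jordan-type decomposition `X_S = Q_+ − Q_−`,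
`Q_± = ¼ Σ_{i,j} σ_iσ_j |x_{ij} ± x_{ji}⟩⟨x_{ij} ± x_{ji}|` (`x_{ij} = |i, e j⟩`) gives `𝒩(X_S) ≤ Tr Q_− = ½((Σσ)² − Σσ²)`,
and the dual certificate `Π = ¼ Σ_{i,j} |x_{ij} − x_{ji}⟩⟨x_{ij} − x_{ji}|` (the projector onto the antisymmetric Schmidt
combinations, `X_S(x_{kl} − x_{lk}) = −σ_kσ_l(x_{kl} − x_{lk})`) gives `𝒩(X_S) ≥ −Tr(X_SΠ) = ½((Σσ)² − Σσ²)` by the dual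
bound `𝒩(A) ≥ −Tr(AΠ)` for `0 ≤ Π ≤ 𝟙` (`neg_re_trace_mul_le_sum_negPart_eigenvalues`, from the Jordan decomposition).
The local unitary `U ⊗ W̄` relating `Ψ = USW^*` to `S` acts on `ρ^{T_A}` as the unitary `Ū ⊗ W̄`
(`PPTOverlap.ptA_localConj`), which leaves `𝒩` invariant (`Negativity.sum_negPart_eigenvalues_unitary_conj`).

## What is formalized (all PROVED)

* § 1 `neg_re_trace_mul_le_sum_negPart_eigenvalues` (dual variational bound).
* § 2 Schmidt coordinates: `ptA_pure_schmidt` (`(|Φ_S⟩⟨Φ_S|)^{T_A} = Σ σ_iσ_j|i,ej⟩⟨j,ei|`), the eigen-relation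
  `schmidtPT_mulVec_antisym`, the decomposition `schmidtPT_eq_sub`, the traces, and
  **`sum_negPart_eigenvalues_schmidtPT`** (`𝒩(X_S) = ½((Σσ)² − Σσ²)`).
* § 3 **Proposition 8**: `exists_schmidt_sum_negPart_eigenvalues_ptA_pure` (for every `Ψ`, `|m| ≤ |n|`: Schmidt
  coefficients `σ ≥ 0` with `ΨΨ^* = U diag(σ²)U^*`, `‖Ψ‖₂² = Σσ²`, and `𝒩((|Ψ⟩⟨Ψ|)^{T_A}) = ½((Σσ)² − Σσ²)`), and for
  unit vectors `vidalWerner_prop8` (`Σσ² = 1`, `𝒩 = ½((Σσ)² − 1)`, `‖(|Φ⟩⟨Φ|)^{T_A}‖₁ = Σ|λ| = (Σσ)²`, and: the pure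
  state is PPT iff `(Σσ)² = 1`).

NOT formalized: the case `|m| > |n|` (symmetric, exchange the factors), the logarithmic negativity `E_𝒩 = 2 log₂ Σc_α`
and the comparison with the entropy of entanglement.

## Tree / Mathlib search (2026-08-31)

`rg -i "negativity|schmidt coeff" Literature/InformationTheory` → `Negativity.lean` (g77), `PartialTransposeSpectrum.
{exists_schmidt, form_schmidt}` (quadratic forms only); no trace norm of a pure state's partial transpose.  REUSED:
`Negativity.{exists_jordan_decomposition, sum_negPart_eigenvalues_le_trace, sum_negPart_eigenvalues_unitary_conj,
sum_abs_eigenvalues_eq_trace_add_two_mul, sum_negPart_eigenvalues_eq_zero_iff}`, `PPTOverlap.{ptA_localConj,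
trace_mul_nonneg_of_posSemidef, conjTranspose_map_star}`, `Nielsen.{kronecker_mulVec_eq_vec, vecMulVec_mulVec}`,
`PPT.ptA_apply`, `LinearAlgebra.Matrix.svd_core`; Mathlib `Pi.single`, `mul_vecMulVec`, `posSemidef_sum`,
`posSemidef_conjTranspose_mul_self`.

presearch: «negativity pure state Schmidt coefficients (sum c)^2 − 1 over 2 trace norm partial transpose flip» →
[corpus: arxiv quant-ph/0102117 § V.A Prop. 8] [corpus: bengtsson2017 § 16.8]; galaxy `"negativity|Schmidt coefficients"`
(pdf) → VW and citing reviews only.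

## References

* [VidalWerner2002] G. Vidal, R. F. Werner, Phys. Rev. A 65 (2002) 032314 (arXiv:quant-ph/0102117), § V.A Proposition 8
  (with § II.A eq. (2) and Lemma 2).
-/

noncomputable section

open Matrix Finset
open scoped ComplexOrder Kronecker

namespace Literature.InformationTheory.Entanglement.PureStateNegativity

open Literature.InformationTheory.Entanglement.PPT (ptA ptA_apply)
open Literature.InformationTheory.Entanglement.PPTOverlap (ptA_localConj trace_mul_nonneg_of_posSemidef
  conjTranspose_map_star)
open Literature.InformationTheory.Entanglement.Negativity (exists_jordan_decomposition sum_negPart_eigenvalues_le_trace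
  sum_negPart_eigenvalues_unitary_conj sum_abs_eigenvalues_eq_trace_add_two_mul sum_negPart_eigenvalues_eq_zero_iff)

/-! ## § 1. The dual variational bound `𝒩(A) ≥ −Tr(AΠ)`, `0 ≤ Π ≤ 𝟙` -/

section Dual

variable {k : Type*} [Fintype k] [DecidableEq k]

/-- The real part of a nonnegative complex number is nonnegative. [folklore] -/
private theorem re_nonneg_of_nonneg {z : ℂ} (hz : 0 ≤ z) : 0 ≤ z.re :=
  (Complex.le_def.1 hz).1.trans_eq' Complex.zero_re.symm

/-- **Dual form of the variational formula**: for every `0 ≤ Π ≤ 𝟙`, `−Tr(AΠ) ≤ 𝒩(A)` (with the Jordan decomposition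
`A = A_+ − A_−`: `−Tr(AΠ) = Tr(A_−Π) − Tr(A_+Π) ≤ Tr(A_−Π) ≤ Tr A_−` — the printed projector step
«`0 ≤ tr[(A + a_−ρ^−)P^−] = −𝒩 + a_−tr[ρ^−P^−]`» read for a general `0 ≤ Π ≤ 𝟙`). [cite: VidalWerner2002, Lemma 2
(proof) and eq. (8)] -/
theorem neg_re_trace_mul_le_sum_negPart_eigenvalues {A T : Matrix k k ℂ} (hA : A.IsHermitian) (hT : T.PosSemidef)
    (hT1 : (1 - T).PosSemidef) : -(A * T).trace.re ≤ ∑ i, (hA.eigenvalues i)⁻ := by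
  obtain ⟨P, Q, hP, hQ, hAeq, -, -, hQtr⟩ := exists_jordan_decomposition hA
  have h1 : 0 ≤ (P * T).trace.re := re_nonneg_of_nonneg (trace_mul_nonneg_of_posSemidef hP hT)
  have h2 : 0 ≤ (Q * (1 - T)).trace.re := re_nonneg_of_nonneg (trace_mul_nonneg_of_posSemidef hQ hT1)
  have h3 : (A * T).trace.re = (P * T).trace.re - Q.trace.re + (Q * (1 - T)).trace.re := by
    rw [hAeq, Matrix.sub_mul, trace_sub, Complex.sub_re, Matrix.mul_sub, Matrix.mul_one, trace_sub, Complex.sub_re]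
    ring
  rw [← hQtr]
  linarith

end Dual

/-! ## § 2. Schmidt coordinates: `X_S = Σ_{i,j} σ_iσ_j |i, e j⟩⟨j, e i|` -/

section Schmidt

variable {m n : Type*} [Fintype m] [Fintype n] [DecidableEq m] [DecidableEq n]

omit [Fintype m] [Fintype n] in
/-- `star |p⟩ = |p⟩` for a computational basis vector. [folklore] -/
private theorem star_single_one (p : m × n) : star (Pi.single p (1 : ℂ) : m × n → ℂ) = Pi.single p 1 := by
  rw [← Pi.single_star, star_one]

/-- The Gram relations `⟨i, e j | k, e l⟩ = δ_{ik}δ_{jl}`. [folklore] -/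
private theorem gram (e : m ↪ n) (i j k l : m) :
    star (Pi.single (i, e j) (1 : ℂ) : m × n → ℂ) ⬝ᵥ Pi.single (k, e l) 1 = if i = k ∧ j = l then 1 else 0 := by
  rw [star_single_one, single_one_dotProduct, Pi.single_apply]
  simp only [Prod.mk.injEq, EmbeddingLike.apply_eq_iff_eq]

omit [DecidableEq m] [DecidableEq n] in
/-- `|u⟩⟨v| w = ⟨v, w⟩ u`. [folklore] -/
private theorem vecMulVec_star_mulVec (u v w : m × n → ℂ) : vecMulVec u (star v) *ᵥ w = (star v ⬝ᵥ w) • u := by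
  funext p
  simp only [mulVec, dotProduct, vecMulVec_apply, Pi.smul_apply, smul_eq_mul, Finset.sum_mul]
  exact Finset.sum_congr rfl fun q _ => by ring

omit [Fintype n] [DecidableEq n] in
/-- Collapse of a double Kronecker-delta sum (inner index first). [folklore] -/
private theorem sum_sum_ite_and_eq {M : Type*} [AddCommMonoid M] (f : m → m → M) (k l : m) :
    ∑ i, ∑ j, (if j = k ∧ i = l then f i j else 0) = f l k := by
  rw [Finset.sum_eq_single l, Finset.sum_eq_single k]
  · rw [if_pos ⟨rfl, rfl⟩]
  · intro j _ hj; rw [if_neg (fun h => hj h.1)]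
  · intro h; exact absurd (mem_univ k) h
  · intro i _ hi; exact Finset.sum_eq_zero fun j _ => by rw [if_neg (fun h => hi h.2)]
  · intro h; exact absurd (mem_univ l) h

omit [Fintype n] [DecidableEq n] in
/-- Collapse of a double Kronecker-delta sum (outer index first). [folklore] -/
private theorem sum_sum_ite_and_eq' {M : Type*} [AddCommMonoid M] (f : m → m → M) (k l : m) :
    ∑ i, ∑ j, (if i = k ∧ j = l then f i j else 0) = f k l := by
  rw [Finset.sum_eq_single k, Finset.sum_eq_single l]
  · rw [if_pos ⟨rfl, rfl⟩]
  · intro j _ hj; rw [if_neg (fun h => hj h.2)]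
  · intro h; exact absurd (mem_univ l) h
  · intro i _ hi; exact Finset.sum_eq_zero fun j _ => by rw [if_neg (fun h => hi h.1)]
  · intro h; exact absurd (mem_univ k) h

omit [Fintype m] [Fintype n] [DecidableEq m] [DecidableEq n] in
/-- `|x+y⟩⟨x+y| − |x−y⟩⟨x−y| = 2(|x⟩⟨y| + |y⟩⟨x|)`. [folklore] -/
private theorem vecMulVec_add_sub_vecMulVec_sub (x y : m × n → ℂ) :
    vecMulVec (x + y) (star (x + y)) - vecMulVec (x - y) (star (x - y)) =
      (2 : ℂ) • (vecMulVec x (star y) + vecMulVec y (star x)) := by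
  ext p q
  simp only [Matrix.sub_apply, Matrix.smul_apply, Matrix.add_apply, vecMulVec_apply, Pi.add_apply, Pi.sub_apply,
    Pi.star_apply, star_add, star_sub, smul_eq_mul]
  ring

omit [Fintype n] in
/-- **`(|Φ_S⟩⟨Φ_S|)^{T_A} = Σ_{α,β} c_αc_β |α, eβ⟩⟨β, eα|`** for the Schmidt-form vector `Φ_S = Σ_α c_α|α, eα⟩`
(coefficient matrix `S_{αc} = c_α[c = eα]`). [cite: VidalWerner2002, § V.A Prop. 8 (proof, first display)] -/
theorem ptA_pure_schmidt (e : m ↪ n) (σ : m → ℝ) :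
    ptA (vecMulVec (fun p : m × n => (Matrix.of fun i c => if c = e i then ((σ i : ℝ) : ℂ) else 0) p.1 p.2)
        (star fun p : m × n => (Matrix.of fun i c => if c = e i then ((σ i : ℝ) : ℂ) else 0) p.1 p.2)) =
      ∑ i, ∑ j, ((σ i * σ j : ℝ) : ℂ) •
        vecMulVec (Pi.single (i, e j) (1 : ℂ) : m × n → ℂ) (star (Pi.single (j, e i) (1 : ℂ) : m × n → ℂ)) := by
  ext ⟨a, c⟩ ⟨b, c'⟩
  simp_rw [star_single_one]
  rw [ptA_apply, vecMulVec_apply, Pi.star_apply, of_apply, of_apply, Matrix.sum_apply]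
  simp_rw [Matrix.sum_apply, Matrix.smul_apply, vecMulVec_apply, Pi.single_apply, smul_eq_mul]
  simp only [Prod.mk.injEq]
  -- collapse the double sum at `i = a`, `j = b`
  rw [Finset.sum_eq_single a, Finset.sum_eq_single b]
  · simp only [true_and]
    by_cases hc : c = e b <;> by_cases hc' : c' = e a <;> simp [hc, hc', mul_comm]
  · intro j _ hj
    rw [if_neg (show ¬(b = j ∧ c' = e a) from fun h => hj h.1.symm), mul_zero, mul_zero]
  · intro h; exact absurd (mem_univ b) h
  · intro i _ hi
    exact Finset.sum_eq_zero fun j _ => by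
      rw [if_neg (show ¬(a = i ∧ c = e j) from fun h => hi h.1.symm), zero_mul, mul_zero]
  · intro h; exact absurd (mem_univ a) h

/-- The action of `X_S = Σ σ_iσ_j|x_{ij}⟩⟨x_{ji}|` on a vector `w`: `X_S w = Σ_{i,j} σ_iσ_j ⟨x_{ji}, w⟩ x_{ij}`. [folklore] -/
private theorem schmidtPT_mulVec (e : m ↪ n) (σ : m → ℝ) (w : m × n → ℂ) :
    (∑ i, ∑ j, ((σ i * σ j : ℝ) : ℂ) •
        vecMulVec (Pi.single (i, e j) (1 : ℂ) : m × n → ℂ) (star (Pi.single (j, e i) (1 : ℂ) : m × n → ℂ))) *ᵥ w =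
      ∑ i, ∑ j, (((σ i * σ j : ℝ) : ℂ) * (star (Pi.single (j, e i) (1 : ℂ) : m × n → ℂ) ⬝ᵥ w)) •
        (Pi.single (i, e j) (1 : ℂ) : m × n → ℂ) := by
  rw [Matrix.sum_mulVec]
  refine Finset.sum_congr rfl fun i _ => ?_
  rw [Matrix.sum_mulVec]
  refine Finset.sum_congr rfl fun j _ => ?_
  rw [smul_mulVec, vecMulVec_star_mulVec, smul_smul]

/-- **The antisymmetric Schmidt combinations are eigenvectors**: `X_S(x_{kl} − x_{lk}) = −σ_kσ_l(x_{kl} − x_{lk})`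
(«… `|e'_α ⊗ e''_β⟩⟨e'_β ⊗ e''_α|`», the flip structure). [cite: VidalWerner2002, § V.A Prop. 8 (proof)] -/
theorem schmidtPT_mulVec_antisym (e : m ↪ n) (σ : m → ℝ) (k l : m) :
    (∑ i, ∑ j, ((σ i * σ j : ℝ) : ℂ) •
        vecMulVec (Pi.single (i, e j) (1 : ℂ) : m × n → ℂ) (star (Pi.single (j, e i) (1 : ℂ) : m × n → ℂ))) *ᵥ
        ((Pi.single (k, e l) (1 : ℂ) : m × n → ℂ) - Pi.single (l, e k) 1) =
      (-(σ k * σ l : ℝ) : ℂ) • ((Pi.single (k, e l) (1 : ℂ) : m × n → ℂ) - Pi.single (l, e k) 1) := by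
  rw [schmidtPT_mulVec]
  simp_rw [dotProduct_sub, gram, mul_sub, sub_smul, Finset.sum_sub_distrib, mul_ite, mul_one, mul_zero, ite_smul,
    zero_smul]
  rw [sum_sum_ite_and_eq (fun i j => ((σ i * σ j : ℝ) : ℂ) • (Pi.single (i, e j) (1 : ℂ) : m × n → ℂ)) k l,
    sum_sum_ite_and_eq (fun i j => ((σ i * σ j : ℝ) : ℂ) • (Pi.single (i, e j) (1 : ℂ) : m × n → ℂ)) l k]
  rw [smul_sub, mul_comm (σ l) (σ k), neg_smul, neg_smul]
  abel

/-- `‖x_{kl} − x_{lk}‖² = 2` for `k ≠ l` (and `0` for `k = l`). [folklore] -/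
private theorem norm_sq_antisym (e : m ↪ n) (k l : m) :
    star ((Pi.single (k, e l) (1 : ℂ) : m × n → ℂ) - Pi.single (l, e k) 1) ⬝ᵥ
        ((Pi.single (k, e l) (1 : ℂ) : m × n → ℂ) - Pi.single (l, e k) 1) =
      ((if k = l then (0 : ℝ) else 2 : ℝ) : ℂ) := by
  rw [star_sub, sub_dotProduct, dotProduct_sub, dotProduct_sub, gram, gram, gram, gram]
  by_cases h : k = l
  · subst h; simp
  · have h1 : ¬(k = l ∧ l = k) := fun hh => h hh.1
    have h2 : ¬(l = k ∧ k = l) := fun hh => h hh.2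
    rw [if_pos (show k = k ∧ l = l from ⟨rfl, rfl⟩), if_neg h1, if_neg h2,
      if_pos (show l = l ∧ k = k from ⟨rfl, rfl⟩), if_neg h]
    push_cast
    ring

omit [Fintype n] in
/-- **The Jordan-type decomposition `X_S = Q_+ − Q_−`**, `Q_± = ¼Σ_{i,j} σ_iσ_j |x_{ij} ± x_{ji}⟩⟨x_{ij} ± x_{ji}|`.
[cite: VidalWerner2002, Lemma 2 with § V.A Prop. 8] -/
theorem schmidtPT_eq_sub (e : m ↪ n) (σ : m → ℝ) :
    (∑ i, ∑ j, ((σ i * σ j : ℝ) : ℂ) •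
        vecMulVec (Pi.single (i, e j) (1 : ℂ) : m × n → ℂ) (star (Pi.single (j, e i) (1 : ℂ) : m × n → ℂ))) =
      (∑ i, ∑ j, ((σ i * σ j / 4 : ℝ) : ℂ) •
        vecMulVec ((Pi.single (i, e j) (1 : ℂ) : m × n → ℂ) + Pi.single (j, e i) 1)
          (star ((Pi.single (i, e j) (1 : ℂ) : m × n → ℂ) + Pi.single (j, e i) 1))) -
      (∑ i, ∑ j, ((σ i * σ j / 4 : ℝ) : ℂ) •
        vecMulVec ((Pi.single (i, e j) (1 : ℂ) : m × n → ℂ) - Pi.single (j, e i) 1)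
          (star ((Pi.single (i, e j) (1 : ℂ) : m × n → ℂ) - Pi.single (j, e i) 1))) := by
  rw [← Finset.sum_sub_distrib]
  simp_rw [← Finset.sum_sub_distrib, ← smul_sub, vecMulVec_add_sub_vecMulVec_sub, smul_smul, smul_add,
    Finset.sum_add_distrib]
  -- the second double sum is the first after exchanging `i` and `j`
  rw [Finset.sum_comm (f := fun i j => (((σ i * σ j / 4 : ℝ) : ℂ) * 2) •
    vecMulVec (Pi.single (j, e i) (1 : ℂ) : m × n → ℂ) (star (Pi.single (i, e j) (1 : ℂ) : m × n → ℂ))),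
    ← Finset.sum_add_distrib]
  refine Finset.sum_congr rfl fun i _ => ?_
  rw [← Finset.sum_add_distrib]
  refine Finset.sum_congr rfl fun j _ => ?_
  rw [← add_smul]
  congr 1
  push_cast
  ring

omit [DecidableEq m] [DecidableEq n] in
/-- `Q_± ⪰ 0` and `Π ⪰ 0`: nonnegative combinations of rank-one projectors. [folklore] -/
private theorem posSemidef_sum_sum_smul_vecMulVec (c : m → m → ℝ) (hc : ∀ i j, 0 ≤ c i j) (v : m → m → m × n → ℂ) :
    (∑ i, ∑ j, ((c i j : ℝ) : ℂ) • vecMulVec (v i j) (star (v i j))).PosSemidef :=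
  posSemidef_sum _ fun i _ => posSemidef_sum _ fun j _ =>
    (posSemidef_vecMulVec_self_star _).smul (Complex.zero_le_real.2 (hc i j))

/-- The common trace computation: `Σ_{k,l} (σ_kσ_l/4)·‖x_{kl} − x_{lk}‖² = ½((Σσ)² − Σσ²)`. [folklore] -/
private theorem sum_sum_mul_norm_sq (σ : m → ℝ) :
    ∑ k, ∑ l, σ k * σ l / 4 * (if k = l then (0 : ℝ) else 2) = ((∑ i, σ i) ^ 2 - ∑ i, σ i ^ 2) / 2 := by
  have h : ∀ k l : m, σ k * σ l / 4 * (if k = l then (0 : ℝ) else 2) =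
      σ k * σ l / 2 - (if k = l then σ k * σ l / 2 else 0) := by
    intro k l; split_ifs <;> ring
  have h2 : ∀ k : m, ∑ l, (σ k * σ l / 2 - if k = l then σ k * σ l / 2 else 0) =
      σ k * (∑ l, σ l) / 2 - σ k ^ 2 / 2 := by
    intro k
    rw [Finset.sum_sub_distrib, Finset.sum_ite_eq, if_pos (mem_univ _), Finset.mul_sum, Finset.sum_div, sq]
  simp_rw [h, h2]
  rw [Finset.sum_sub_distrib, ← Finset.sum_div, ← Finset.sum_mul, ← Finset.sum_div, sq]
  ring

/-- **`Tr Q_− = ½((Σσ)² − Σσ²)`**. [cite: VidalWerner2002, § V.A Prop. 8 with Lemma 2] -/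
theorem re_trace_Qminus (e : m ↪ n) (σ : m → ℝ) :
    (∑ i, ∑ j, ((σ i * σ j / 4 : ℝ) : ℂ) •
        vecMulVec ((Pi.single (i, e j) (1 : ℂ) : m × n → ℂ) - Pi.single (j, e i) 1)
          (star ((Pi.single (i, e j) (1 : ℂ) : m × n → ℂ) - Pi.single (j, e i) 1))).trace.re =
      ((∑ i, σ i) ^ 2 - ∑ i, σ i ^ 2) / 2 := by
  rw [← sum_sum_mul_norm_sq σ, trace_sum, Complex.re_sum]
  refine Finset.sum_congr rfl fun i _ => ?_
  rw [trace_sum, Complex.re_sum]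
  refine Finset.sum_congr rfl fun j _ => ?_
  rw [trace_smul, trace_vecMulVec, dotProduct_comm, norm_sq_antisym, smul_eq_mul, ← Complex.ofReal_mul,
    Complex.ofReal_re]

/-- **`Tr(X_SΠ) = −½((Σσ)² − Σσ²)`** for the antisymmetric projector `Π = ¼Σ|x_{kl} − x_{lk}⟩⟨x_{kl} − x_{lk}|`.
[cite: VidalWerner2002, § V.A Prop. 8 with Lemma 2] -/
theorem re_trace_schmidtPT_mul_proj (e : m ↪ n) (σ : m → ℝ) :
    ((∑ i, ∑ j, ((σ i * σ j : ℝ) : ℂ) •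
        vecMulVec (Pi.single (i, e j) (1 : ℂ) : m × n → ℂ) (star (Pi.single (j, e i) (1 : ℂ) : m × n → ℂ))) *
      ∑ k, ∑ l, ((1 / 4 : ℝ) : ℂ) •
        vecMulVec ((Pi.single (k, e l) (1 : ℂ) : m × n → ℂ) - Pi.single (l, e k) 1)
          (star ((Pi.single (k, e l) (1 : ℂ) : m × n → ℂ) - Pi.single (l, e k) 1))).trace.re =
      -(((∑ i, σ i) ^ 2 - ∑ i, σ i ^ 2) / 2) := by
  rw [← sum_sum_mul_norm_sq σ, Finset.mul_sum, trace_sum, Complex.re_sum, ← Finset.sum_neg_distrib]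
  refine Finset.sum_congr rfl fun k _ => ?_
  rw [Finset.mul_sum, trace_sum, Complex.re_sum, ← Finset.sum_neg_distrib]
  refine Finset.sum_congr rfl fun l _ => ?_
  rw [Matrix.mul_smul, mul_vecMulVec, schmidtPT_mulVec_antisym, trace_smul, trace_vecMulVec, smul_dotProduct,
    dotProduct_comm, norm_sq_antisym, smul_eq_mul, smul_eq_mul, ← Complex.ofReal_neg, ← Complex.ofReal_mul,
    ← Complex.ofReal_mul, Complex.ofReal_re]
  ring

/-- **`Π` fixes the antisymmetric combinations**: `Π(x_{ij} − x_{ji}) = x_{ij} − x_{ji}`. [folklore] -/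
private theorem proj_mulVec_antisym (e : m ↪ n) (i j : m) :
    (∑ k, ∑ l, ((1 / 4 : ℝ) : ℂ) •
        vecMulVec ((Pi.single (k, e l) (1 : ℂ) : m × n → ℂ) - Pi.single (l, e k) 1)
          (star ((Pi.single (k, e l) (1 : ℂ) : m × n → ℂ) - Pi.single (l, e k) 1))) *ᵥ
        ((Pi.single (i, e j) (1 : ℂ) : m × n → ℂ) - Pi.single (j, e i) 1) =
      (Pi.single (i, e j) (1 : ℂ) : m × n → ℂ) - Pi.single (j, e i) 1 := by
  rw [Matrix.sum_mulVec]
  simp_rw [Matrix.sum_mulVec, smul_mulVec, vecMulVec_star_mulVec, smul_smul, star_sub, sub_dotProduct,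
    dotProduct_sub, gram]
  -- `⟨x_kl − x_lk, x_ij − x_ji⟩ = 2[k=i∧l=j] − 2[k=j∧l=i]`
  have h : ∀ k l : m, ((if k = i ∧ l = j then (1 : ℂ) else 0) - (if k = j ∧ l = i then 1 else 0) -
      ((if l = i ∧ k = j then (1 : ℂ) else 0) - (if l = j ∧ k = i then 1 else 0))) =
      2 * (if k = i ∧ l = j then 1 else 0) - 2 * (if k = j ∧ l = i then 1 else 0) := by
    intro k l
    have hBA : (if l = i ∧ k = j then (1 : ℂ) else 0) = if k = j ∧ l = i then 1 else 0 := by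
      by_cases hh : k = j ∧ l = i
      · rw [if_pos hh, if_pos ⟨hh.2, hh.1⟩]
      · rw [if_neg hh, if_neg (fun h' => hh ⟨h'.2, h'.1⟩)]
    have hAB : (if l = j ∧ k = i then (1 : ℂ) else 0) = if k = i ∧ l = j then 1 else 0 := by
      by_cases hh : k = i ∧ l = j
      · rw [if_pos hh, if_pos ⟨hh.2, hh.1⟩]
      · rw [if_neg hh, if_neg (fun h' => hh ⟨h'.2, h'.1⟩)]
    rw [hBA, hAB]
    ring
  simp_rw [h, mul_sub, sub_smul, Finset.sum_sub_distrib, mul_ite, mul_one, mul_zero, ite_smul, zero_smul]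
  simp only [sum_sum_ite_and_eq']
  rw [← smul_sub, show ((Pi.single (i, e j) (1 : ℂ) : m × n → ℂ) - Pi.single (j, e i) 1 -
      ((Pi.single (j, e i) (1 : ℂ) : m × n → ℂ) - Pi.single (i, e j) 1)) =
      (2 : ℂ) • ((Pi.single (i, e j) (1 : ℂ) : m × n → ℂ) - Pi.single (j, e i) 1) by module, smul_smul]
  rw [show ((1 / 4 : ℝ) : ℂ) * 2 * 2 = 1 by push_cast; norm_num, one_smul]


/-- `Π² = Π` for the antisymmetric projector. [folklore] -/
private theorem proj_mul_self (e : m ↪ n) :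
    (∑ k, ∑ l, ((1 / 4 : ℝ) : ℂ) •
        vecMulVec ((Pi.single (k, e l) (1 : ℂ) : m × n → ℂ) - Pi.single (l, e k) 1)
          (star ((Pi.single (k, e l) (1 : ℂ) : m × n → ℂ) - Pi.single (l, e k) 1))) *
      (∑ k, ∑ l, ((1 / 4 : ℝ) : ℂ) •
        vecMulVec ((Pi.single (k, e l) (1 : ℂ) : m × n → ℂ) - Pi.single (l, e k) 1)
          (star ((Pi.single (k, e l) (1 : ℂ) : m × n → ℂ) - Pi.single (l, e k) 1))) =
      ∑ k, ∑ l, ((1 / 4 : ℝ) : ℂ) •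
        vecMulVec ((Pi.single (k, e l) (1 : ℂ) : m × n → ℂ) - Pi.single (l, e k) 1)
          (star ((Pi.single (k, e l) (1 : ℂ) : m × n → ℂ) - Pi.single (l, e k) 1)) := by
  rw [Finset.mul_sum]
  refine Finset.sum_congr rfl fun i _ => ?_
  rw [Finset.mul_sum]
  refine Finset.sum_congr rfl fun j _ => ?_
  rw [Matrix.mul_smul, mul_vecMulVec, proj_mulVec_antisym]

/-- `0 ≤ Π`. [folklore] -/
private theorem posSemidef_proj (e : m ↪ n) :
    (∑ k, ∑ l, ((1 / 4 : ℝ) : ℂ) •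
        vecMulVec ((Pi.single (k, e l) (1 : ℂ) : m × n → ℂ) - Pi.single (l, e k) 1)
          (star ((Pi.single (k, e l) (1 : ℂ) : m × n → ℂ) - Pi.single (l, e k) 1))).PosSemidef :=
  posSemidef_sum_sum_smul_vecMulVec (fun _ _ => 1 / 4) (fun _ _ => by norm_num) _

/-- `Π ≤ 𝟙`: `𝟙 − Π = (𝟙 − Π)^*(𝟙 − Π)` for the projector `Π`. [folklore] -/
private theorem posSemidef_one_sub_proj (e : m ↪ n) :
    (1 - ∑ k, ∑ l, ((1 / 4 : ℝ) : ℂ) •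
        vecMulVec ((Pi.single (k, e l) (1 : ℂ) : m × n → ℂ) - Pi.single (l, e k) 1)
          (star ((Pi.single (k, e l) (1 : ℂ) : m × n → ℂ) - Pi.single (l, e k) 1))).PosSemidef := by
  have hH := (posSemidef_proj e).isHermitian
  have h2 := proj_mul_self e
  have key : (1 - ∑ k, ∑ l, ((1 / 4 : ℝ) : ℂ) •
        vecMulVec ((Pi.single (k, e l) (1 : ℂ) : m × n → ℂ) - Pi.single (l, e k) 1)
          (star ((Pi.single (k, e l) (1 : ℂ) : m × n → ℂ) - Pi.single (l, e k) 1))) =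
      (1 - ∑ k, ∑ l, ((1 / 4 : ℝ) : ℂ) •
        vecMulVec ((Pi.single (k, e l) (1 : ℂ) : m × n → ℂ) - Pi.single (l, e k) 1)
          (star ((Pi.single (k, e l) (1 : ℂ) : m × n → ℂ) - Pi.single (l, e k) 1)))ᴴ *
      (1 - ∑ k, ∑ l, ((1 / 4 : ℝ) : ℂ) •
        vecMulVec ((Pi.single (k, e l) (1 : ℂ) : m × n → ℂ) - Pi.single (l, e k) 1)
          (star ((Pi.single (k, e l) (1 : ℂ) : m × n → ℂ) - Pi.single (l, e k) 1))) := by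
    rw [conjTranspose_sub, conjTranspose_one, hH.eq, sub_mul, one_mul, Matrix.mul_sub, Matrix.mul_one, h2, sub_self,
      sub_zero]
  rw [key]
  exact posSemidef_conjTranspose_mul_self _

/-- **`𝒩(X_S) = ½((Σσ)² − Σσ²)`** for `X_S = Σ_{i,j} σ_iσ_j |i,ej⟩⟨j,ei|`, `σ ≥ 0` (upper bound from the
decomposition `X_S = Q_+ − Q_−`, lower bound from the antisymmetric projector). [cite: VidalWerner2002, § V.A Prop. 8] -/
theorem sum_negPart_eigenvalues_schmidtPT (e : m ↪ n) (σ : m → ℝ) (hσ : ∀ i, 0 ≤ σ i)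
    (hH : (∑ i, ∑ j, ((σ i * σ j : ℝ) : ℂ) •
        vecMulVec (Pi.single (i, e j) (1 : ℂ) : m × n → ℂ) (star (Pi.single (j, e i) (1 : ℂ) : m × n → ℂ))).IsHermitian) :
    ∑ i, (hH.eigenvalues i)⁻ = ((∑ i, σ i) ^ 2 - ∑ i, σ i ^ 2) / 2 := by
  have hc : ∀ i j, 0 ≤ σ i * σ j / 4 := fun i j => div_nonneg (mul_nonneg (hσ i) (hσ j)) (by norm_num)
  refine le_antisymm ?_ ?_
  · calc ∑ i, (hH.eigenvalues i)⁻ ≤ _ :=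
          sum_negPart_eigenvalues_le_trace hH (posSemidef_sum_sum_smul_vecMulVec _ hc _)
            (posSemidef_sum_sum_smul_vecMulVec _ hc _) (schmidtPT_eq_sub e σ)
      _ = ((∑ i, σ i) ^ 2 - ∑ i, σ i ^ 2) / 2 := re_trace_Qminus e σ
  · have h := neg_re_trace_mul_le_sum_negPart_eigenvalues hH (posSemidef_proj e) (posSemidef_one_sub_proj e)
    rw [re_trace_schmidtPT_mul_proj, neg_neg] at h
    exact h

/-- Transport of `𝒩` along an equality of matrices (the Hermitian witnesses differ only propositionally). [folklore] -/
private theorem sum_negPart_eigenvalues_congr {q : Type*} [Fintype q] [DecidableEq q] {X Y : Matrix q q ℂ}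
    (hX : X.IsHermitian) (hY : Y.IsHermitian) (h : X = Y) :
    ∑ i, (hX.eigenvalues i)⁻ = ∑ i, (hY.eigenvalues i)⁻ := by
  subst h; rfl

/-- **`𝒩((|Φ_S⟩⟨Φ_S|)^{T_A}) = ½((Σσ)² − Σσ²)`** for the Schmidt-form vector `Φ_S = Σ_α σ_α|α, eα⟩`, `σ ≥ 0`.
[cite: VidalWerner2002, § V.A Prop. 8] -/
theorem sum_negPart_eigenvalues_ptA_pure_schmidt (e : m ↪ n) (σ : m → ℝ) (hσ : ∀ i, 0 ≤ σ i)
    (hH : (ptA (vecMulVec (fun p : m × n => (Matrix.of fun i c => if c = e i then ((σ i : ℝ) : ℂ) else 0) p.1 p.2)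
      (star fun p : m × n => (Matrix.of fun i c => if c = e i then ((σ i : ℝ) : ℂ) else 0) p.1 p.2))).IsHermitian) :
    ∑ i, (hH.eigenvalues i)⁻ = ((∑ i, σ i) ^ 2 - ∑ i, σ i ^ 2) / 2 := by
  have hXS : (∑ i, ∑ j, ((σ i * σ j : ℝ) : ℂ) •
      vecMulVec (Pi.single (i, e j) (1 : ℂ) : m × n → ℂ) (star (Pi.single (j, e i) (1 : ℂ) : m × n → ℂ))).IsHermitian := by
    rw [← ptA_pure_schmidt]; exact hH
  rw [sum_negPart_eigenvalues_congr hH hXS (ptA_pure_schmidt e σ)]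
  exact sum_negPart_eigenvalues_schmidtPT e σ hσ hXS

end Schmidt

/-! ## § 3. Proposition 8: `𝒩(|Φ⟩⟨Φ|) = ½((Σ_α c_α)² − 1)` -/

section PureStates

variable {m n : Type*} [Fintype m] [Fintype n] [DecidableEq m] [DecidableEq n]

omit [Fintype m] [Fintype n] [DecidableEq m] [DecidableEq n] in
/-- `Ā B̄ = \overline{AB}`. [folklore] -/
private theorem map_star_mul {q : Type*} [Fintype q] (A : Matrix m q ℂ) (B : Matrix q n ℂ) :
    (A * B).map star = A.map star * B.map star := by
  rw [← conjTranspose_transpose, conjTranspose_mul, transpose_mul]; rfl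

omit [Fintype n] [DecidableEq n] in
/-- `Ū` is unitary when `U` is. [folklore] -/
private theorem map_star_mem_unitaryGroup {U : Matrix m m ℂ} (hU : U ∈ Matrix.unitaryGroup m ℂ) :
    U.map star ∈ Matrix.unitaryGroup m ℂ := by
  rw [Matrix.mem_unitaryGroup_iff, Matrix.star_eq_conjTranspose] at hU ⊢
  have h := congrArg (fun X : Matrix m m ℂ => X.map star) hU
  simp only [map_star_mul] at h
  rw [conjTranspose_map_star]
  have h2 : (Uᴴ).map star = Uᵀ := by rw [← conjTranspose_transpose, conjTranspose_conjTranspose]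
  rw [h2] at h
  rw [h]
  ext a b
  simp [Matrix.one_apply]

/-- `U ⊗ W` is unitary when `U, W` are. [folklore] -/
private theorem kronecker_mem_unitaryGroup {U : Matrix m m ℂ} {W : Matrix n n ℂ} (hU : U ∈ Matrix.unitaryGroup m ℂ)
    (hW : W ∈ Matrix.unitaryGroup n ℂ) : U ⊗ₖ W ∈ Matrix.unitaryGroup (m × n) ℂ := by
  rw [Matrix.mem_unitaryGroup_iff, Matrix.star_eq_conjTranspose] at hU hW ⊢
  rw [conjTranspose_kronecker, ← mul_kronecker_mul, hU, hW, one_kronecker_one]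

omit [DecidableEq m] [DecidableEq n] in
/-- `Tr |vec Ψ⟩⟨vec Ψ| = ‖Ψ‖₂² = Tr(Ψ^*Ψ)`. [folklore] -/
private theorem trace_vecMulVec_vec (Ψ : Matrix m n ℂ) :
    (vecMulVec (fun p : m × n => Ψ p.1 p.2) (star fun p : m × n => Ψ p.1 p.2)).trace = (Ψᴴ * Ψ).trace := by
  rw [trace_vecMulVec, dotProduct, Fintype.sum_prod_type]
  simp only [Pi.star_apply, Matrix.trace, diag_apply, mul_apply, conjTranspose_apply]
  rw [Finset.sum_comm]
  exact Finset.sum_congr rfl fun _ _ => Finset.sum_congr rfl fun _ _ => mul_comm _ _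

/-- **Proposition 8 (Vidal–Werner), unnormalised form.** For every `Ψ ∈ ℂ^{m×n}` (`|m| ≤ |n|`) there are Schmidt
coefficients `σ_α ≥ 0` — `ΨΨ^* = U diag(σ²) U^*`, `‖Ψ‖₂² = Σ_α σ_α²` — with
`𝒩((|Ψ⟩⟨Ψ|)^{T_A}) = ½((Σ_α σ_α)² − Σ_α σ_α²)`. [cite: VidalWerner2002, § V.A Prop. 8] -/
theorem exists_schmidt_sum_negPart_eigenvalues_ptA_pure (Ψ : Matrix m n ℂ) (hmn : Fintype.card m ≤ Fintype.card n)
    (hH : (ptA (vecMulVec (fun p : m × n => Ψ p.1 p.2) (star fun p : m × n => Ψ p.1 p.2))).IsHermitian) :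
    ∃ σ : m → ℝ, (∀ i, 0 ≤ σ i) ∧
      (∃ U ∈ Matrix.unitaryGroup m ℂ, Ψ * Ψᴴ = U * diagonal (fun i => ((σ i ^ 2 : ℝ) : ℂ)) * star U) ∧
      ((Ψᴴ * Ψ).trace).re = ∑ i, σ i ^ 2 ∧
      ∑ i, (hH.eigenvalues i)⁻ = ((∑ i, σ i) ^ 2 - ∑ i, σ i ^ 2) / 2 := by
  obtain ⟨e⟩ := Function.Embedding.nonempty_iff_card_le.2 hmn
  obtain ⟨U, hU, W, hW, σ, hσ, hΨW', hΨΨ⟩ := Literature.LinearAlgebra.Matrix.svd_core Ψ e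
  have hΨW : Ψ * W = U * (Matrix.of fun i c => if c = e i then ((σ i : ℝ) : ℂ) else 0) := hΨW'
  have hWW : W * Wᴴ = 1 := by rw [← star_eq_conjTranspose]; exact Matrix.mem_unitaryGroup_iff.mp hW
  have hΨ : Ψ = U * (Matrix.of fun i c => if c = e i then ((σ i : ℝ) : ℂ) else 0) * Wᴴ := by
    rw [← hΨW, Matrix.mul_assoc, hWW, Matrix.mul_one]
  refine ⟨σ, hσ, ⟨U, hU, hΨΨ⟩, ?_, ?_⟩
  · -- `‖Ψ‖₂² = Tr(ΨΨ^*) = Tr(U diag(σ²) U^*) = Σσ²`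
    have hUU : star U * U = 1 := Matrix.mem_unitaryGroup_iff'.mp hU
    rw [← trace_mul_comm, hΨΨ, Matrix.mul_assoc, trace_mul_comm, Matrix.mul_assoc, hUU, Matrix.mul_one,
      trace_diagonal, Complex.re_sum]
    exact Finset.sum_congr rfl fun i _ => Complex.ofReal_re _
  · -- the local unitary `U ⊗ W̄` and its action `Ū ⊗ W̄` on the partial transpose
    have hvec : (fun p : m × n => Ψ p.1 p.2) = (U ⊗ₖ W.map star) *ᵥ
        fun p : m × n => (Matrix.of fun i c => if c = e i then ((σ i : ℝ) : ℂ) else 0) p.1 p.2 := by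
      rw [Literature.InformationTheory.Entanglement.Nielsen.kronecker_mulVec_eq_vec]
      have hM : U * (Matrix.of fun a b => (fun p : m × n =>
          (Matrix.of fun i c => if c = e i then ((σ i : ℝ) : ℂ) else 0) p.1 p.2) (a, b)) * (W.map star)ᵀ = Ψ := by
        rw [hΨ]
        congr 1
      rw [hM]
    have hP : vecMulVec (fun p : m × n => Ψ p.1 p.2) (star fun p : m × n => Ψ p.1 p.2) =
        (U ⊗ₖ W.map star) *
          vecMulVec (fun p : m × n => (Matrix.of fun i c => if c = e i then ((σ i : ℝ) : ℂ) else 0) p.1 p.2)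
            (star fun p : m × n => (Matrix.of fun i c => if c = e i then ((σ i : ℝ) : ℂ) else 0) p.1 p.2) *
          (U ⊗ₖ W.map star)ᴴ := by
      rw [hvec]
      exact Literature.InformationTheory.Entanglement.Nielsen.vecMulVec_mulVec _ _
    have hPT : ptA (vecMulVec (fun p : m × n => Ψ p.1 p.2) (star fun p : m × n => Ψ p.1 p.2)) =
        (U.map star ⊗ₖ W.map star) *
          ptA (vecMulVec (fun p : m × n => (Matrix.of fun i c => if c = e i then ((σ i : ℝ) : ℂ) else 0) p.1 p.2)
            (star fun p : m × n => (Matrix.of fun i c => if c = e i then ((σ i : ℝ) : ℂ) else 0) p.1 p.2)) *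
          (U.map star ⊗ₖ W.map star)ᴴ := by
      rw [hP, ptA_localConj]
    have hV : U.map star ⊗ₖ W.map star ∈ Matrix.unitaryGroup (m × n) ℂ :=
      kronecker_mem_unitaryGroup (map_star_mem_unitaryGroup hU) (map_star_mem_unitaryGroup hW)
    have hXS : (ptA (vecMulVec
        (fun p : m × n => (Matrix.of fun i c => if c = e i then ((σ i : ℝ) : ℂ) else 0) p.1 p.2)
        (star fun p : m × n => (Matrix.of fun i c => if c = e i then ((σ i : ℝ) : ℂ) else 0) p.1 p.2))).IsHermitian :=
      Literature.InformationTheory.Entanglement.MaximalBallPPT.isHermitian_ptA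
        (posSemidef_vecMulVec_self_star _).isHermitian
    have hconj : ((U.map star ⊗ₖ W.map star) *
        ptA (vecMulVec (fun p : m × n => (Matrix.of fun i c => if c = e i then ((σ i : ℝ) : ℂ) else 0) p.1 p.2)
          (star fun p : m × n => (Matrix.of fun i c => if c = e i then ((σ i : ℝ) : ℂ) else 0) p.1 p.2)) *
        (U.map star ⊗ₖ W.map star)ᴴ).IsHermitian := by
      rw [← hPT]; exact hH
    rw [sum_negPart_eigenvalues_congr hH hconj hPT, sum_negPart_eigenvalues_unitary_conj hXS hV hconj]
    exact sum_negPart_eigenvalues_ptA_pure_schmidt e σ hσ hXS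

/-- **Proposition 8 (Vidal–Werner): `𝒩(|Φ⟩⟨Φ|) = ½((Σ_α c_α)² − 1)` and `‖(|Φ⟩⟨Φ|)^{T_A}‖₁ = (Σ_α c_α)²`** for a unit
vector `Φ` with Schmidt coefficients `c_α` (`|m| ≤ |n|`); in particular `Φ` is PPT iff `(Σc_α)² = Σc_α² (= 1)`, i.e.
iff it is a product vector. [cite: VidalWerner2002, § V.A Prop. 8 and § II.A eq. (2)] -/
theorem vidalWerner_prop8 (Ψ : Matrix m n ℂ) (hmn : Fintype.card m ≤ Fintype.card n) (hΨ1 : (Ψᴴ * Ψ).trace = 1)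
    (hH : (ptA (vecMulVec (fun p : m × n => Ψ p.1 p.2) (star fun p : m × n => Ψ p.1 p.2))).IsHermitian) :
    ∃ σ : m → ℝ, (∀ i, 0 ≤ σ i) ∧
      (∃ U ∈ Matrix.unitaryGroup m ℂ, Ψ * Ψᴴ = U * diagonal (fun i => ((σ i ^ 2 : ℝ) : ℂ)) * star U) ∧
      ∑ i, σ i ^ 2 = 1 ∧
      ∑ i, (hH.eigenvalues i)⁻ = ((∑ i, σ i) ^ 2 - 1) / 2 ∧
      ∑ i, |hH.eigenvalues i| = (∑ i, σ i) ^ 2 ∧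
      ((ptA (vecMulVec (fun p : m × n => Ψ p.1 p.2) (star fun p : m × n => Ψ p.1 p.2))).PosSemidef ↔
        (∑ i, σ i) ^ 2 = 1) := by
  obtain ⟨σ, hσ, hU, htr, hN⟩ := exists_schmidt_sum_negPart_eigenvalues_ptA_pure Ψ hmn hH
  have h1 : ∑ i, σ i ^ 2 = 1 := by rw [← htr, hΨ1, Complex.one_re]
  rw [h1] at hN
  have hρ1 : (vecMulVec (fun p : m × n => Ψ p.1 p.2) (star fun p : m × n => Ψ p.1 p.2)).trace = 1 := by
    rw [trace_vecMulVec_vec, hΨ1]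
  refine ⟨σ, hσ, hU, h1, hN, ?_, ?_⟩
  · rw [Literature.InformationTheory.Entanglement.Negativity.sum_abs_eigenvalues_ptA hρ1 hH, hN]
    ring
  · rw [← sum_negPart_eigenvalues_eq_zero_iff hH, hN]
    constructor
    · intro h; linarith
    · intro h; rw [h]; ring

end PureStates

end Literature.InformationTheory.Entanglement.PureStateNegativity
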